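import Summits.CriticalPhenomena.PercolationContinuityZ3.Theorems.PercNearOneGluingNoHeavyQuantGatedSliceMixLawA5Cells
import Summits.CriticalPhenomena.PercolationContinuityZ3.Theorems.PercNearOneGluingNoHeavyQuantGatedSliceMixLawA5Fit
import Summits.CriticalPhenomena.PercolationContinuityZ3.Theorems.PercNearOneGluingNoHeavyQuantGatedSliceMixLawA5Mix
import Summits.CriticalPhenomena.PercolationContinuityZ3.Theorems.PercNearOneGluingNoHeavyQuantGatedSliceMixLawA5Fill
import Summits.CriticalPhenomena.PercolationContinuityZ3.Theorems.PercNearOneGluingNoHeavyQuantGatedSliceMixLawA5Incomp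
import Summits.CriticalPhenomena.PercolationContinuityZ3.Theorems.PercNearOneGluingNoHeavyQuantGatedSliceMixLawHeavyTop
import HarnessLib

/-!
# QUANT lane R8, T-DEC, leg (III), blob case — `LawDec.MixLawCellA5` (the unsaturated-mid mixture cell of `GatedSliceMixLaw'`) FROM ITS
# ONE RESIDUAL SUB-CELL: `MixLawCellA5r → MixLawCellA5`

builds on p205010 (kernel theorem, internal audit signed; external expert review pending)

Support file (`--supports stmt-CriticalPhenomena-4575`), QUANT lane lead seat prim-quant-lead (gen 33), rung R8 of
`run/shared/lean/prim/quant/LADDER.md`.  Lead g33 NOTES §A5.  One theorem, standard axioms, no sorries, no definitions.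

THE CASE ANALYSIS (typer g30's plan Π-B2, memo MIXLAW-MIXTURES-G30 §8, completed by the lead):
* `k₁ = 0`: `gatedSliceMixLaw_zero` (arm-2 g35; the top is automatically heavy).
* `k₁ ≥ 1`, `k₁ + k₂ ≤ t` (sub-cell (iii)): the moved law is DEC by itself — `decAtT_movedTwoPoint_of_incomp` (`…A5Incomp`).
* `k₁ ≥ 1`, `t < k₁ + k₂`, both lows fit into `k₂` (sub-cell (i)): `decAtT_movedTwoPoint_of_bothFit` (typer g30, `…A5Fit`).
* not both fit, the pair `(k₁,k₂)` light or `k₁ ≥ t − S` (sub-cell (ii)): the genuine mixture `gatedSliceMixLaw_cellA5_mix` (`…A5Mix`).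
* not both fit, heavy pair, `k₁ < t − S` (sub-cell (ii′)): the filling routing `decAtT_movedTwoPoint_of_fill` with the offer inequality from
  the load bound (`movedTwoPoint_off_of_loadBound`, `…A5Fill`) — the load bound being kernel when the shifted low is heavy at `k₂`
  (`loadBound_of_heavyShift`) or the bracket is small (`loadBound_of_smallBracket`); the remaining corner is EXACTLY the typed residual
  `MixLawCellA5r` (`…A5Cells`; census 65 000 / 0).
With this file the node reads `gatedSliceMixLaw'_of_residualCells : MixLawCellA5 → MixLawCellQ4 → MixLawCellQH → MixLawCellQK → MixLawRegimeB →
GatedSliceMixLaw'` (typer g30, `…AssemblyA`) with `MixLawCellA5 ⟸ MixLawCellA5r` (here) and `MixLawRegimeB ⟸` census-2 g61's case tree.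
HONEST STATUS: `MixLawCellA5r`, `MixLawCellQ4/QH/QK`, the regime-B sub-cells, `GatedSliceMixLaw'`, CW, `GateMove`, `TreeDEC`, `FarTreeRow`
OPEN; RATE class log* / honest sentence unchanged.

* **`LawDec.mixLawCellA5_of_residual : MixLawCellA5r → MixLawCellA5`**.

[this work]; sub-cell theorems: typer g30 (i), arm-2 g35 (k₁ = 0), lead g33 (ii), (ii′), (iii).  The gluing rows served
[cite: KozmaNitzan2024, Conjecture 3 (p. 15)]; product measure [cite: Grimmett1999, §1.3 p. 10].
-/

noncomputable section

namespace Summit.CriticalPhenomena.PercolationContinuityZ3.Theorems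

namespace Quant

open Finset

/-- the two-point law `{lo, hi; g}` (as in `…QuantLawDEC`) -/
local notation3 "TP[" lo ", " hi ", " g ", " h "]" =>
  (g : ℝ) * (if (h : ℕ) = (hi : ℕ) then (1 : ℝ) else 0) + (1 - (g : ℝ)) * (if (h : ℕ) = (lo : ℕ) then (1 : ℝ) else 0)

namespace LawDec

set_option maxHeartbeats 800000 in
/-- **CELL A5 FROM ITS RESIDUAL SUB-CELL.**  See the file header for the case analysis. [this work] -/
theorem mixLawCellA5_of_residual (hR : MixLawCellA5r) : MixLawCellA5 := by
  intro y z g S lam a j M h k₁ k₂ hy0 hy1 hz0 hz1 hg1 hyg ha hjM hS0 hta hhj hhM hSh _hW hk hk₂M hlam0 hlam1 hmean hllow hlj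
    hk₂j hk₂mid hcompl hk₂aG hunsat hhaj hhmid
  classical
  -- a DEC certificate of the moved law alone gives the conclusion with θ = 0
  have wrap : DECAtT y (S + (a : ℝ) * g * (1 - z)) j (M + a)
      (fun p => z * (if p = 0 then (1 : ℝ) else 0) + (1 - z) * slice (fun q => TP[k₁, k₂, lam, q]) a g p) →
      ∃ θ : ℝ, 0 ≤ θ ∧ θ < 1 ∧
        DECAtT y (S + (a : ℝ) * g * (1 - z)) j (M + a)
          (fun p => θ * weakMidLaw S g h a p
            + (1 - θ) * (z * (if p = 0 then (1 : ℝ) else 0) + (1 - z) * slice (fun q => TP[k₁, k₂, lam, q]) a g p)) := by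
    intro hdec
    refine ⟨0, le_rfl, zero_lt_one, decAtT_congr (fun p => ?_) hdec⟩
    ring
  have hunsat' : usage y (S + (a : ℝ) * g * (1 - z)) j (k₁ + a) k₂ * ((1 - z) * (1 - lam) * g) ≤ (1 - z) * lam * (1 - g) := by
    rw [mul_comm]; exact hunsat
  have hg0 : 0 < g := by nlinarith
  have ha0 : (0 : ℝ) ≤ a := Nat.cast_nonneg a
  have hSj : S < (j : ℝ) := lt_of_lt_of_le hSh (by exact_mod_cast hhj)
  have hSM : S < (M : ℝ) := lt_of_lt_of_le hSh (by exact_mod_cast hhM)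
  -- k₁ = 0
  rcases Nat.eq_zero_or_pos k₁ with hk0 | hk₁
  · subst hk0
    exact gatedSliceMixLaw_zero y z g S lam a j M h k₂ hy0 hy1 hz0 hz1 hg1 hyg ha hS0 hta hk₂M hlam0 hlam1 hmean
  -- sub-cell (iii): k₁ incompatible with k₂
  by_cases hinc : (k₁ : ℝ) + k₂ ≤ S + (a : ℝ) * g * (1 - z)
  · exact wrap (decAtT_movedTwoPoint_of_incomp y z g S lam a j M k₁ k₂ hy0 hy1 hz0 hz1 hg1 hyg ha hta hk hk₂M hlam0 hlam1 hmean hk₁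
      hllow hlj hk₂j hk₂mid hcompl hk₂aG hunsat' hinc)
  have hcomp₁ : S + (a : ℝ) * g * (1 - z) < (k₁ : ℝ) + k₂ := lt_of_not_ge hinc
  -- sub-cell (i): both lows fit
  by_cases hfit : usage y (S + (a : ℝ) * g * (1 - z)) j (k₁ + a) k₂ * ((1 - z) * (1 - lam) * g)
      + usage y (S + (a : ℝ) * g * (1 - z)) j k₁ k₂ * ((1 - z) * (1 - lam) * (1 - g)) ≤ (1 - z) * lam * (1 - g)
  · exact wrap (decAtT_movedTwoPoint_of_bothFit y z g S lam a j M k₁ k₂ hy0 hy1 hz0 hz1 hg1 hyg hta hk hk₂M hlam0 hlam1 hmean hk₁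
      hllow hlj hk₂j hk₂mid hcomp₁ hk₂aG hfit)
  have hfull : (1 - z) * lam * (1 - g) < usage y (S + (a : ℝ) * g * (1 - z)) j (k₁ + a) k₂ * ((1 - z) * (1 - lam) * g)
      + usage y (S + (a : ℝ) * g * (1 - z)) j k₁ k₂ * ((1 - z) * (1 - lam) * (1 - g)) := lt_of_not_ge hfit
  -- sub-cell (ii): light pair or k₁ ≥ t − S — the genuine mixture
  by_cases hcase : S + (a : ℝ) * g * (1 - z) - 2 * (k₁ : ℝ) < y * ((k₂ : ℝ) - k₁) ∨ S + (a : ℝ) * g * (1 - z) - S ≤ (k₁ : ℝ)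
  · exact gatedSliceMixLaw_cellA5_mix y z g S lam a j M h k₁ k₂ hy0 hy1 hz0 hz1 hg1 hyg hjM hS0 hta hhM hSh hk hk₂M hlam0 hlam1
      hmean hllow hlj hk₂j hk₂mid hcomp₁ hk₂aG hhaj hhmid hunsat' hfull hcase
  -- sub-cell (ii′): heavy pair and k₁ < ag(1−z)
  rw [not_or, not_lt, not_le] at hcase
  obtain ⟨hheavy, hsmall⟩ := hcase
  have hsmall' : (k₁ : ℝ) < (a : ℝ) * g * (1 - z) := by linarith
  have htaG : y * ((k₂ : ℝ) + a) ≤ S + (a : ℝ) * g * (1 - z) := by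
    have : (k₂ : ℝ) ≤ M := by exact_mod_cast hk₂M
    nlinarith [mul_nonneg ha0 hg0.le]
  have hyk₂ : y * (k₂ : ℝ) ≤ S := le_trans (mul_le_mul_of_nonneg_left (by exact_mod_cast hk₂M) hy0.le) hta
  have hSt : S ≤ S + (a : ℝ) * g * (1 - z) := by nlinarith [mul_nonneg ha0 hg0.le]
  have htSl : S + (a : ℝ) * g * (1 - z) - S ≤ ((k₁ + a : ℕ) : ℝ) := by
    push_cast; nlinarith [mul_nonneg ha0 hg0.le, mul_nonneg (mul_nonneg ha0 hg0.le) hz0]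
  -- S < k₂ (λ < 1 by hfull)
  have hSk₂ : S < (k₂ : ℝ) := by
    have h1z : 0 < 1 - z := by linarith
    have hlam1' : lam < 1 := by
      by_contra hc
      have hl1 : lam = 1 := le_antisymm hlam1 (not_lt.1 hc)
      rw [hl1] at hfull
      have : (0 : ℝ) ≤ (1 - z) * 1 * (1 - g) := mul_nonneg (mul_nonneg h1z.le zero_le_one) (by linarith)
      simp only [sub_self, mul_zero, zero_mul, add_zero] at hfull
      linarith
    have hk' : (k₁ : ℝ) < k₂ := by push_cast at hllow; linarith
    rw [← hmean]
    have h1 : (k₁ : ℝ) + ((k₂ : ℝ) - k₁) * lam < k₂ := by nlinarith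
    have h2 : 0 ≤ (k₁ : ℝ) + ((k₂ : ℝ) - k₁) * lam := by nlinarith
    nlinarith
  -- the two kernel cases of the load bound, else the residual cell
  have fill : (S + (a : ℝ) * g * (1 - z)) * ((k₂ : ℝ) + k₁ - (S + (a : ℝ) * g * (1 - z)))
        * usage y (S + (a : ℝ) * g * (1 - z)) j (k₁ + a) k₂
      ≤ (S + (a : ℝ) * g * (1 - z) - ((k₁ + a : ℕ) : ℝ)) * (S + (a : ℝ) * g * (1 - z) - 2 * (k₁ : ℝ)) →
      ∃ θ : ℝ, 0 ≤ θ ∧ θ < 1 ∧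
        DECAtT y (S + (a : ℝ) * g * (1 - z)) j (M + a)
          (fun p => θ * weakMidLaw S g h a p
            + (1 - θ) * (z * (if p = 0 then (1 : ℝ) else 0) + (1 - z) * slice (fun q => TP[k₁, k₂, lam, q]) a g p)) := by
    intro hLB
    have hoff := movedTwoPoint_off_of_loadBound y z g S lam a j k₁ k₂ hy0 hy1 hz0 hz1 hg0 hg1 ha hlam0 hlam1 hmean hllow hcomp₁ hk₂j
      htaG hheavy hLB
    exact wrap (decAtT_movedTwoPoint_of_fill y z g S lam a j M k₁ k₂ hy0 hy1 hz0 hz1 hg1 hyg ha hta hk hk₂M hlam0 hlam1 hmean hk₁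
      hllow hlj hk₂mid hcomp₁ hk₂aG hunsat' hfull.le hoff)
  by_cases hshift : y * ((k₂ : ℝ) - ((k₁ + a : ℕ) : ℝ)) ≤ S + (a : ℝ) * g * (1 - z) - 2 * ((k₁ + a : ℕ) : ℝ)
  · -- the shifted low is heavy at k₂
    have hk₁a : k₁ ≤ a := by
      have : (k₁ : ℝ) < a := by nlinarith [mul_nonneg ha0 hg0.le]
      exact_mod_cast this.le
    exact fill (loadBound_of_heavyShift y (S + (a : ℝ) * g * (1 - z)) a j k₁ k₂ hy0 hy1 hk₁a hllow hcomp₁ hk₂j hshift)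
  by_cases hbr : 2 * (k₁ : ℝ) * ((k₂ : ℝ) - S) ≤ (S + (a : ℝ) * g * (1 - z)) * (S + (a : ℝ) * g * (1 - z) - S - (k₁ : ℝ))
  · -- small bracket
    exact fill (loadBound_of_smallBracket y (S + (a : ℝ) * g * (1 - z)) S a j k₁ k₂ hy0 hy1 hllow hcompl hk₂j hyk₂ hSk₂ hSt htSl hbr)
  -- the residual cell
  exact wrap (hR y z g S lam a j M k₁ k₂ hy0 hy1 hz0 hz1 hg1 hyg ha hjM hS0 hta hSj hSM hk hk₂M hlam0 hlam1 hmean hk₁ hllow hlj hk₂j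
    hk₂mid hcompl hk₂aG hunsat' hfull hcomp₁ hheavy hsmall' (lt_of_not_ge hshift) (lt_of_not_ge hbr))

end LawDec

end Quant

end Summit.CriticalPhenomena.PercolationContinuityZ3.Theorems
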